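import Summits.AtomisticToContinuum.Crystallization.Theorems.SlackRigidity.Negative.WitnessBasics
import Literature.Probability.Process.LocallyMatches
import Literature.Probability.Process.RootedHardCoreConfig
import Mathlib
import HarnessLib

/-!
# Line `ekeland-surgery-parity` (crux `SlackRigidity`, stmt-AtomisticToContinuum-11960): matching at every scale and tolerance is exact congruence

Stub `eq_image_of_forall_locallyMatches` of lead c14's law-rigidity programme (worker W3): a
deterministic upgrade from local matchings to exact congruence.  Let `S ⊆ ℝ³` be `δ`-separated
(`δ > 0`) and let `P₀` be a periodic configuration.  If for every radius `R > 0` and tolerance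
`ε > 0` some rotation `A` of the template matches `S` locally, `LocallyMatches R ε S (A '' P₀.points)`,
then `S = A∞ '' P₀.points` for one linear isometry `A∞`.

Proof.  Choose `A n` matching at `(n + 1, 1 / (n + 1))`.  The linear isometries of `ℝ³` form a
compact set (closed unit ball of the finite-dimensional space `ℝ³ →L[ℝ] ℝ³`), so a subsequence
`A (φ j)` converges pointwise to a linear isometry `A∞` (`exists_tendsto_linearIsometry`).
* `S ⊆ A∞ '' P₀.points`: for `q ∈ S` the template points `p` with `dist q (A (φ j) p) ≤ 1/(φ j + 1)`
  lie in the FINITE set `B̄(0, ‖q‖ + 1) ∩ P₀.points` (local finiteness of a periodic configuration);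
  if none of them had `A∞ p = q`, then for large `j` every such `p` would satisfy
  `1/(φ j + 1) < dist q (A (φ j) p)`, contradicting the matching.
* `A∞ '' P₀.points ⊆ S`: for `p ∈ P₀.points` the matching gives points of `S` within `1/(φ j + 1)` of
  `A (φ j) p → A∞ p`, and `S` is closed (a separated set is closed).
All `[folklore]`.
-/

noncomputable section

open scoped BigOperators Topology
open MeasureTheory Filter Set
open Literature.Probability.Process
open Literature.MathematicalPhysics.StatisticalMechanics
open Summit.AtomisticToContinuum.Crystallization.Theorems.SlackRigidityNegative (E3)

namespace Summit.AtomisticToContinuum.Crystallization.Theorems.SlackRigidityLawCongruence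

/-- **Sequential compactness of the linear isometries of `ℝ³`** (pointwise form): every sequence of
linear isometries `A n : ℝ³ →ₗᵢ ℝ³` has a subsequence converging pointwise to a linear isometry.
(The associated continuous linear maps lie in the closed unit ball of the finite-dimensional, hence
proper, space `ℝ³ →L[ℝ] ℝ³`; a limit of norm-preserving maps preserves norms.) [folklore] -/
theorem exists_tendsto_linearIsometry (A : ℕ → E3 →ₗᵢ[ℝ] E3) :
    ∃ (B : E3 →ₗᵢ[ℝ] E3) (φ : ℕ → ℕ), StrictMono φ ∧
      ∀ p : E3, Tendsto (fun j => A (φ j) p) atTop (𝓝 (B p)) := by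
  have hmem : ∀ n, (A n).toContinuousLinearMap ∈ Metric.closedBall (0 : E3 →L[ℝ] E3) 1 :=
    fun n => mem_closedBall_zero_iff.2 (A n).norm_toContinuousLinearMap_le
  obtain ⟨T, -, φ, hφ, hlim⟩ :=
    (isCompact_closedBall (0 : E3 →L[ℝ] E3) 1).tendsto_subseq hmem
  have hpt : ∀ p : E3, Tendsto (fun j => A (φ j) p) atTop (𝓝 (T p)) := fun p => by
    have h := ((continuous_eval_const p).tendsto T).comp hlim
    simpa [Function.comp_def] using h
  have hT : ∀ x : E3, ‖T x‖ = ‖x‖ := fun x => by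
    refine tendsto_nhds_unique (hpt x).norm ?_
    simp only [LinearIsometry.norm_map]
    exact tendsto_const_nhds
  exact ⟨⟨(T : E3 →ₗ[ℝ] E3), hT⟩, φ, hφ, hpt⟩

/-- **Matching at every scale and tolerance is exact congruence.**  If a `δ`-separated (`δ > 0`)
configuration `S ⊆ ℝ³` is, for every `R > 0` and `ε > 0`, locally `(R, ε)`-matched with some
rotation `A '' P₀.points` of a periodic template `P₀`, then `S = A '' P₀.points` for one linear
isometry `A` (compactness of the isometries, local finiteness of `P₀.points`, closedness of `S`).
[folklore] -/
theorem eq_image_of_forall_locallyMatches : ∀ (P₀ : PeriodicConfiguration 3) (S : Set E3) (δ : ℝ),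
    0 < δ → (∀ x ∈ S, ∀ y ∈ S, x ≠ y → δ ≤ dist x y) →
    (∀ R ε : ℝ, 0 < R → 0 < ε → ∃ A : E3 →ₗᵢ[ℝ] E3, LocallyMatches R ε S (A '' P₀.points)) →
    ∃ A : E3 →ₗᵢ[ℝ] E3, S = A '' P₀.points := by
  intro P₀ S δ hδ hsep hmatch
  choose A hA using fun n : ℕ =>
    hmatch ((n : ℝ) + 1) (1 / ((n : ℝ) + 1)) (Nat.cast_add_one_pos n) Nat.one_div_pos_of_nat
  obtain ⟨B, φ, hφ, hpt⟩ := exists_tendsto_linearIsometry A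
  have hR : Tendsto (fun j => (φ j : ℝ) + 1) atTop atTop :=
    tendsto_atTop_add_const_right _ 1
      ((tendsto_natCast_atTop_atTop (R := ℝ)).comp hφ.tendsto_atTop)
  have hε : Tendsto (fun j => 1 / ((φ j : ℝ) + 1)) atTop (𝓝 0) :=
    (tendsto_one_div_add_atTop_nhds_zero_nat (𝕜 := ℝ)).comp hφ.tendsto_atTop
  refine ⟨B, Subset.antisymm (fun q hqS => ?_) ?_⟩
  · -- `S ⊆ B '' P₀.points`: pigeonhole on the finitely many template points near `q`
    have hfin : (Metric.closedBall (0 : E3) (‖q‖ + 1) ∩ P₀.points).Finite :=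
      P₀.finite_inter_points Metric.isBounded_closedBall
    by_contra hq
    have hpos : ∀ p ∈ Metric.closedBall (0 : E3) (‖q‖ + 1) ∩ P₀.points, 0 < dist q (B p) := by
      rintro p ⟨-, hp⟩
      exact dist_pos.2 fun h => hq ⟨p, hp, h.symm⟩
    have hev : ∀ᶠ j in atTop, ∀ p ∈ Metric.closedBall (0 : E3) (‖q‖ + 1) ∩ P₀.points,
        1 / ((φ j : ℝ) + 1) < dist q (A (φ j) p) := by
      refine hfin.eventually_all.2 fun p hp => ?_
      have h1 := ((tendsto_const_nhds (x := q)).dist (hpt p)).eventually_const_lt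
        (half_lt_self (hpos p hp))
      have h2 := hε.eventually_lt_const (half_pos (hpos p hp))
      exact (h1.and h2).mono fun j hj => hj.2.trans hj.1
    obtain ⟨j, hj, hjq⟩ := (hev.and (hR.eventually_ge_atTop ‖q‖)).exists
    obtain ⟨_, ⟨p, hp, rfl⟩, hd⟩ := (hA (φ j)).2 q hqS hjq
    have hle : 1 / ((φ j : ℝ) + 1) ≤ 1 := by
      rw [div_le_one (Nat.cast_add_one_pos _)]
      exact le_add_of_nonneg_left (Nat.cast_nonneg _)
    have hpB : p ∈ Metric.closedBall (0 : E3) (‖q‖ + 1) ∩ P₀.points := by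
      refine ⟨mem_closedBall_zero_iff.2 ?_, hp⟩
      calc ‖p‖ = ‖A (φ j) p‖ := ((A (φ j)).norm_map p).symm
        _ ≤ ‖q‖ + ‖q - A (φ j) p‖ := norm_le_norm_add_norm_sub _ _
        _ = ‖q‖ + dist q (A (φ j) p) := by rw [dist_eq_norm]
        _ ≤ ‖q‖ + 1 := by linarith
    exact (hj p hpB).not_ge hd
  · -- `B '' P₀.points ⊆ S`: `S` is closed and `A (φ j) p → B p` is approached by points of `S`
    rintro _ ⟨p, hp, rfl⟩
    rw [Metric.mem_of_closed' (LocalConfig.isClosed_of_separated hδ hsep)]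
    intro η hη
    have h1 : ∀ᶠ j in atTop, dist (A (φ j) p) (B p) < η / 2 :=
      Metric.tendsto_nhds.1 (hpt p) _ (half_pos hη)
    have h2 := hε.eventually_lt_const (half_pos hη)
    obtain ⟨j, ⟨hj1, hj2⟩, hjp⟩ := ((h1.and h2).and (hR.eventually_ge_atTop ‖p‖)).exists
    obtain ⟨q, hqS, hd⟩ := (hA (φ j)).1 (A (φ j) p) (mem_image_of_mem _ hp)
      (by rwa [LinearIsometry.norm_map])
    refine ⟨q, hqS, ?_⟩
    calc dist (B p) q ≤ dist (B p) (A (φ j) p) + dist (A (φ j) p) q := dist_triangle _ _ _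
      _ < η / 2 + η / 2 := by
          rw [dist_comm (B p) (A (φ j) p), dist_comm (A (φ j) p) q]
          exact add_lt_add hj1 (hd.trans_lt hj2)
      _ = η := add_halves η

end Summit.AtomisticToContinuum.Crystallization.Theorems.SlackRigidityLawCongruence

end
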